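import Summits.QuantumFields.BalabanUV.Beta.SymRootedAveragingMatrix
import Summits.QuantumFields.BalabanUV.Beta.DshAn1Spread
import Summits.QuantumFields.BalabanUV.Beta.SymShiftedSpread
import Summits.QuantumFields.BalabanUV.Beta.BorderedHessianBlind

/-!
# `BalabanUV.Beta.CombChartSpreadBlind` — binder row D1, RULING R-D1-g35-1 (hR repair route (β) = CHART (III′)), brick **B1**:
# THE (0.4)-SYMMETRISED LEGGED BORDER `bhK + Dsh` AND THE SHIFTED SPREAD `bhKStepSh d Lc (Dsh Lc) j` ARE BLIND, ON BOTH SIDES,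
# TO THE ROOTED COMB DRESSING `piK (ctr (d+1) Lc) Lc` (every level `j`, centred in-block root)

HONEST FRAMING (cell charter, verbatim): «discharging `BetaPertH` makes Bałaban's UV stability UNCONDITIONAL — a real constructive-QFT
result; it is NOT the continuum limit and NOT the Clay problem.»  HONEST DEPENDENCY (verbatim): «continuum YM on T⁴ ⇐ BetaPertH ∧ nine
spine estimates (0/9 proved); BetaPertH ⇐ (D1) ∧ (D4) ∧ CAP+tail; G-an2-4 gates asym, D1 and NE2/3/4.»  THIS MODULE DISCHARGES NOTHING of
row D1 ∕ `BetaPertH`: it is [folklore] Form-level and kernel-level bookkeeping over OUR objects (`symTreeGaugeAt`, `SymLamAt`, `symLinAvgAt`,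
`axProjAt`, `piK`, `bhK`, `Dsh`, `bhKStepSh`).  No `def`, no `def … : Prop`, nothing cited, 0 sorry.  It is ONE input (the blindness K1 = B1)
of the owner's relative-inverse brick P2 `RelInv (coDressKAt (ctr) Lc (Gsym Lc j)) (bhKStepSh d Lc (Dsh Lc) j) (axEc (ctr) Lc)`; it does NOT
prove P2, does NOT repair hR, does NOT touch the root of record.  NOT D1, NOT BetaPertH, NOT continuum, NOT Clay.

ABSOLUTE RULE (cell, verbatim): «No internally-minted statement may enter as a cited fact. Every hypothesis is either kernel-proved in this
package or a verbatim quotation of a PUBLISHED theorem with page reference.»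

WHY (owner an2 g35 memo `R-D1-g35-1-CHART-IIIprime.v1.md` §2 B1; an1 g49 W-an1-g49-1 (a)–(c); an3 g78 W-an3-g78-1 (V4)).  The straight
border `±𝒬` of `bhK` SEES the rooted comb projector (`AxialProjectorBlockMean.contourSum_axProjAt`, NOTE X-an2-42) and so does the (0.4) leg
`Dsh` ALONE (each carries `± dz ∘ blockSum` of the dressing's tree gauge); their SUM is the legged border `±[coarse]·((d+1)!)⁻¹·symLinAvgAt ρ_c`
(`DshAn1.bhK_add_Dsh_inr_inl ∕ _inl_inr`), which reads an exact form AT BLOCK ROOTS ONLY (`symLinAvgAt_grad`), where the rooted tree gauge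
vanishes (`RootedComb.treeGaugeAt_root`).  Kernel form (over `SymRootedAveragingMatrix`: the Form-level representations `hasSum_…_delta1`, the heart `symLinAvgAt_axProjAt` —
credit an1 g49 (G3) ∕ an3 g78 — and the columns of `trK (piK (toSite r) N)`): §3 the action of the multiplier rows of `bhK + Dsh`
(`comp_bhK_add_Dsh_inr`: `[coarse]·((d+1)!)⁻¹·symLinAvgAt ρ_c (fcol X)`) and **`comp_bhKSym_trK_piK` ∕ `comp_piK_bhKSym`** (`j = 0`);
§4 **`comp_bhKStepSh_succ_trK_piK` ∕ `comp_piK_bhKStepSh_succ`** (`j + 1`: field rows = bounded co-closed `wVH·wΦ`, border = `stepScale ·` §3)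
and the wrappers `comp_bhKStepSh_trK_piK` ∕ `comp_piK_bhKStepSh` (every `j`).  LEFT from RIGHT by `trK = sgnK` (`trK_bhKSym`, `trK_bhKStepSh_succ`).
Patterns copied BY NAME: `BorderedHessianBlind` (an2 g13), `SymBorderedHessianStepBlind` (an2 g25), `ValueHessianBlind`.
Unit `b2b-balaban-beta-d1-formalise-leaf-03` gen 19 (D1 formalisation swarm), 2026-08-21; row-D1 owner `b2b-balaban-beta-an2`.
-/

noncomputable section

open Finset
open scoped BigOperators Nat
open Literature.Probability.LatticeModels (Torus.proj)
open Literature.MathematicalPhysics.QuantumFieldTheory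
open Literature.MathematicalPhysics.QuantumFieldTheory.Balaban1983to89
open Literature.MathematicalPhysics.QuantumFieldTheory.Balaban1983to89.Beta
open ExpKernelCalculus (MKer comp)
open AffineAveraging (Form0 Form1 Site box toSite unitVec curv curvAdj)
open AveragingContoursRooted (ctr ctrOff ctrOff_mem_box)
open KKTFluctuationKernel (delta1)
open KernelSpecInstance (wΦ)
open LatticeForm (quo)
open OneStepResolventKernel (Fib)
open BalabanStepJetsSucc (wVH)
open Summit.QuantumFields.BalabanUV.Beta.TameKernelCalculus
open Summit.QuantumFields.BalabanUV.Beta.AxialDressingRooted (piK piK_inl_inl piK_inl_inr piK_inr_inl piK_inr_inr one_le_of_neZero)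
open Summit.QuantumFields.BalabanUV.Beta.BorderedHessian (bhK bhK_inl_inr bhK_inr_inl bhK_inr_inr bhK_inl_inl_eq fcol fcol_apply tsum_bhK_inl_inl
  sgnK sgnK_apply sgnF_inl sgnF_inr comp_sgnK trK_bhK codiff₁_wΦ_right exists_abs_wΦ_le E2_inl_inl_eq_wΦ bhKStep bhKStep_succ_inl_inl
  bhKStep_succ_inl_inr bhKStep_succ_inr_inl bhKStep_succ_inr_inr trK_bhKStep_succ stepScale)
open Summit.QuantumFields.BalabanUV.Beta.SymmetrisedAxialPotential
open Summit.QuantumFields.BalabanUV.Beta.SymRootedAveragingMatrix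
open Summit.QuantumFields.BalabanUV.Beta.SymShiftedSpread (bhKStepSh bhKStepSh_apply bhKStepSh_zero)
open Summit.QuantumFields.BalabanUV.Beta.DshAn1

namespace Summit.QuantumFields.BalabanUV.Beta.CombChartSpreadBlind

variable {d : ℕ}

/-! ## §3 Level `0`: the (0.4)-symmetrised rooted bordered Hessian `bhK + Dsh` is blind to the centred comb dressing -/

section Zero

variable {N : ℕ}

/-- [folklore] **ACTION LEMMA, MULTIPLIER ROWS OF THE LEGGED BORDER**: for ANY kernel `X`,
`((bhK N + Dsh N) ∘ X)(x, z, inr m, b) = [proj N x = 0] · ((d+1)!)⁻¹ · symLinAvgAt ρ_c (fcol X z b) N m (quo N x)` — the multiplier row of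
`bhK + Dsh` IS the functional `((d+1)!)⁻¹·symLinAvgAt ρ_c` (`bhK_add_Dsh_inr_inl` + `hasSum_symLinAvgAt_delta1`); no summability hypothesis. -/
theorem comp_bhK_add_Dsh_inr [NeZero N] (X : MKer (d + 1) (Fib d)) (x z : Fin (d + 1) → ℤ) (m : Fin (d + 1)) (b : Fib d) :
    comp (bhK N + Dsh N) X x z (Sum.inr m) b
      = if Torus.proj N x = 0 then ((d + 1) ! : ℝ)⁻¹ * symLinAvgAt (ctr (d + 1) N) (fcol X z b) N m (quo N x) else 0 := by
  have hN : 1 ≤ N := one_le_of_neZero N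
  unfold ExpKernelCalculus.comp
  have e : ∀ y, ∑ f : Fib d, (bhK N + Dsh N : MKer (d + 1) (Fib d)) x y (Sum.inr m) f * X y z f b
      = ∑ l : Fin (d + 1), (bhK N + Dsh N : MKer (d + 1) (Fib d)) x y (Sum.inr m) (Sum.inl l) * X y z (Sum.inl l) b := by
    intro y
    rw [Fintype.sum_sum_type]
    simp only [Pi.add_apply, bhK_inr_inr, Dsh_inr_inr, add_zero, zero_mul, Finset.sum_const_zero]
  simp_rw [e]
  by_cases hx : Torus.proj N x = 0
  · simp_rw [bhK_add_Dsh_inr_inl, if_pos hx, mul_assoc, ← Finset.mul_sum]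
    rw [tsum_mul_left]
    congr 1
    exact (hasSum_symLinAvgAt_delta1 hN (ctrOff_mem_box hN) (fcol X z b) m (quo N x)).tsum_eq
  · simp_rw [bhK_add_Dsh_inr_inl, if_neg hx, zero_mul, Finset.sum_const_zero, tsum_zero]

/-- [folklore] **B1 AT LEVEL `0`, RIGHT: THE (0.4)-SYMMETRISED ROOTED BORDERED HESSIAN `bhK N + Dsh N` IS BLIND TO THE CENTRED COMB DRESSING**,
`comp (bhK N + Dsh N) (trK (piK (ctr (d+1) N) N)) = bhK N + Dsh N`.  Field rows: `d*d` kills the gradient correction and the field row of `Dsh`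
vanishes; multiplier rows: the legged-border functional against the column `Π_c δ_{(β,z)}` (§3 action lemma + `symLinAvgAt_axProjAt`);
multiplier columns untouched.  CONTRAST: the straight `bhK N` alone is NOT blind to `piK (ctr)` (X-an2-42) — the (0.4) legs cancel the defect. -/
theorem comp_bhKSym_trK_piK [NeZero N] :
    comp (bhK N + Dsh N) (trK (piK (ctr (d + 1) N) N)) = bhK N + Dsh (d := d) N := by
  have hN : 1 ≤ N := one_le_of_neZero N
  have hr : ctrOff (d + 1) N ∈ box (d + 1) N := ctrOff_mem_box hN
  rw [show ctr (d + 1) N = toSite (ctrOff (d + 1) N) from rfl]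
  funext x z a b
  rcases b with β | μ
  · rcases a with κ | m
    · unfold ExpKernelCalculus.comp
      have e : ∀ y, ∑ f : Fib d, (bhK N + Dsh N : MKer (d + 1) (Fib d)) x y (Sum.inl κ) f * trK (piK (toSite (ctrOff (d + 1) N)) N) y z f (Sum.inl β)
          = ∑ l : Fin (d + 1), bhK N x y (Sum.inl κ) (Sum.inl l) * trK (piK (toSite (ctrOff (d + 1) N)) N) y z (Sum.inl l) (Sum.inl β) := by
        intro y
        rw [Fintype.sum_sum_type]
        simp only [Pi.add_apply, Dsh_inl_inl, add_zero, trK_apply, piK_inl_inr, mul_zero, Finset.sum_const_zero]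
      simp_rw [e]
      rw [tsum_bhK_inl_inl, fcol_trK_piK_inl hN hr, curv_axProjAt, ← bhK_inl_inl_eq N x z κ β]
      simp only [Pi.add_apply, Dsh_inl_inl, add_zero]
    · rw [comp_bhK_add_Dsh_inr, fcol_trK_piK_inl hN hr, bhK_add_Dsh_inr_inl,
        show ctr (d + 1) N = toSite (ctrOff (d + 1) N) from rfl, symLinAvgAt_axProjAt hr]
  · exact comp_trK_piK_inr _ _ _ _ _ _ _

/-- [folklore] The legged bordered Hessian is sign-conjugate symmetric: `trK (bhK N + Dsh N) = sgnK (bhK N + Dsh N)` (`trK_bhK`, `trK_Dsh = −Dsh`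
on the mixed blocks only). -/
theorem trK_bhKSym [NeZero N] : trK (bhK N + Dsh (d := d) N) = sgnK (bhK N + Dsh N) := by
  funext x y a b
  rw [trK_add, trK_bhK, trK_Dsh]
  simp only [Pi.add_apply, Pi.neg_apply, sgnK_apply]
  rcases a with κ | κ <;> rcases b with l | l
  · simp
  · simp only [sgnF_inl, sgnF_inr]; ring
  · simp only [sgnF_inl, sgnF_inr]; ring
  · simp [bhK_inr_inr]

/-- [folklore] **B1 AT LEVEL `0`, LEFT**: `comp (piK (ctr (d+1) N) N) (bhK N + Dsh N) = bhK N + Dsh N` — by transposition through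
`trK_bhKSym` and `sgnK_trK_piK` (pattern `BorderedHessianBlind.comp_piKBm_bhK`). -/
theorem comp_piK_bhKSym [NeZero N] :
    comp (piK (ctr (d + 1) N) N) (bhK N + Dsh N) = bhK N + Dsh (d := d) N := by
  have h : trK (comp (piK (ctr (d + 1) N) N) (bhK N + Dsh N)) = trK (bhK N + Dsh (d := d) N) := by
    rw [trK_comp, trK_bhKSym, ← sgnK_trK_piK, comp_sgnK, comp_bhKSym_trK_piK]
  have h' := congrArg trK h
  rwa [trK_trK, trK_trK] at h'

end Zero

/-! ## §4 Level `j + 1`: the shifted spread `bhKStepSh d Lc (Dsh Lc) (j+1)` is blind to the centred comb dressing; every `j` -/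

section Step

variable {Lc : ℕ} [NeZero Lc]

/-- [folklore] Field–field entry of the shifted spread at `j + 1`: the weighted value Hessian `wVH (j+1) · wΦ κ l (x − y)` (`Dsh_inl_inl = 0`). -/
theorem bhKStepSh_succ_inl_inl (j : ℕ) (x y : Fin (d + 1) → ℤ) (κ l : Fin (d + 1)) :
    bhKStepSh d Lc (Dsh Lc) (j + 1) x y (Sum.inl κ) (Sum.inl l) = wVH d Lc (j + 1) * wΦ (N := Lc ^ (j + 1)) κ l (x - y) := by
  rw [bhKStepSh_apply]
  simp only [Pi.add_apply, Pi.smul_apply, smul_eq_mul, bhKStep_succ_inl_inl, E2_inl_inl_eq_wΦ, Dsh_inl_inl, mul_zero, add_zero]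

/-- [folklore] Multiplier rows of the shifted spread at `j + 1` are `stepScale (j+1) ·` those of the legged border `bhK Lc + Dsh Lc`. -/
theorem bhKStepSh_succ_inr (j : ℕ) (x y : Fin (d + 1) → ℤ) (m : Fin (d + 1)) (f : Fib d) :
    bhKStepSh d Lc (Dsh Lc) (j + 1) x y (Sum.inr m) f = stepScale d Lc (j + 1) * (bhK Lc + Dsh Lc : MKer (d + 1) (Fib d)) x y (Sum.inr m) f := by
  rw [bhKStepSh_apply]
  rcases f with l | m'
  · simp only [Pi.add_apply, Pi.smul_apply, smul_eq_mul, bhKStep_succ_inr_inl]; ring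
  · simp only [Pi.add_apply, Pi.smul_apply, smul_eq_mul, bhKStep_succ_inr_inr, bhK_inr_inr, Dsh_inr_inr]; ring

/-- [folklore] Hence `(bhKStepSh (j+1) ∘ X)(x, z, inr m, b) = stepScale (j+1) · ((bhK Lc + Dsh Lc) ∘ X)(x, z, inr m, b)` for ANY kernel `X`. -/
theorem comp_bhKStepSh_succ_inr (j : ℕ) (X : MKer (d + 1) (Fib d)) (x z : Fin (d + 1) → ℤ) (m : Fin (d + 1)) (b : Fib d) :
    comp (bhKStepSh d Lc (Dsh Lc) (j + 1)) X x z (Sum.inr m) b = stepScale d Lc (j + 1) * comp (bhK Lc + Dsh Lc) X x z (Sum.inr m) b := by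
  unfold ExpKernelCalculus.comp
  rw [← tsum_mul_left]
  refine tsum_congr fun y => ?_
  rw [Finset.mul_sum]
  exact Finset.sum_congr rfl fun f _ => by rw [bhKStepSh_succ_inr, mul_assoc]

/-- [folklore] **B1 AT LEVEL `j + 1`, RIGHT: THE SHIFTED SPREAD IS BLIND TO THE CENTRED COMB DRESSING**,
`comp (bhKStepSh d Lc (Dsh Lc) (j+1)) (trK (piK (ctr (d+1) Lc) Lc)) = bhKStepSh d Lc (Dsh Lc) (j+1)`.  Field rows = the bounded co-closed
`wVH·wΦ` rows reproduced by `tsum_mul_piK_inl_inl` (gauge-agnostic; the field row of `Dsh` is zero); multiplier rows = `stepScale ·` level `0`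
(`comp_bhKSym_trK_piK`); multiplier columns untouched. -/
theorem comp_bhKStepSh_succ_trK_piK (j : ℕ) :
    comp (bhKStepSh d Lc (Dsh Lc) (j + 1)) (trK (piK (ctr (d + 1) Lc) Lc)) = bhKStepSh d Lc (Dsh Lc) (j + 1) := by
  have hLc : 1 ≤ Lc := one_le_of_neZero Lc
  have hr : ctrOff (d + 1) Lc ∈ box (d + 1) Lc := ctrOff_mem_box hLc
  have h0 := comp_bhKSym_trK_piK (d := d) (N := Lc)
  rw [show ctr (d + 1) Lc = toSite (ctrOff (d + 1) Lc) from rfl] at h0 ⊢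
  obtain ⟨C, hC⟩ := exists_abs_wΦ_le (N := Lc ^ (j + 1)) (d := d)
  funext x z a b
  rcases b with β | μ
  · rcases a with κ | m
    · unfold ExpKernelCalculus.comp
      have e : ∀ y, ∑ f : Fib d, bhKStepSh d Lc (Dsh Lc) (j + 1) x y (Sum.inl κ) f * trK (piK (toSite (ctrOff (d + 1) Lc)) Lc) y z f (Sum.inl β)
          = wVH d Lc (j + 1) * ∑ l : Fin (d + 1),
              wΦ (N := Lc ^ (j + 1)) κ l (x - y) * piK (toSite (ctrOff (d + 1) Lc)) Lc z y (Sum.inl β) (Sum.inl l) := by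
        intro y
        rw [Fintype.sum_sum_type, Finset.mul_sum]
        simp only [trK_apply, piK_inl_inr, mul_zero, Finset.sum_const_zero, add_zero, bhKStepSh_succ_inl_inl, mul_assoc]
      simp_rw [e]
      rw [tsum_mul_left, tsum_mul_piK_inl_inl hLc hr (A := fun l y => wΦ (N := Lc ^ (j + 1)) κ l (x - y)) (fun l y => hC κ l (x - y))
        (codiff₁_wΦ_right κ x) z β, bhKStepSh_succ_inl_inl]
    · have h0' := congrFun (congrFun (congrFun (congrFun h0 x) z) (Sum.inr m)) (Sum.inl β)
      rw [comp_bhKStepSh_succ_inr, h0', bhKStepSh_succ_inr]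
  · exact comp_trK_piK_inr _ _ _ _ _ _ _

/-- [folklore] The shifted spread at `j + 1` is sign-conjugate symmetric: `trK (bhKStepSh (j+1)) = sgnK (bhKStepSh (j+1))`
(`trK_bhKStep_succ` + the antisymmetric placement of `Dsh`). -/
theorem trK_bhKStepSh_succ (j : ℕ) : trK (bhKStepSh d Lc (Dsh Lc) (j + 1)) = sgnK (bhKStepSh d Lc (Dsh Lc) (j + 1)) := by
  funext x y a b
  rw [bhKStepSh_apply, trK_add, trK_bhKStep_succ]
  simp only [Pi.add_apply, Pi.smul_apply, smul_eq_mul, trK_apply, sgnK_apply]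
  rcases a with κ | κ <;> rcases b with l | l
  · simp
  · rw [Dsh_inr_inl_eq_neg]; simp only [sgnF_inl, sgnF_inr]; ring
  · rw [Dsh_inr_inl_eq_neg]; simp only [sgnF_inl, sgnF_inr]; ring
  · simp [bhKStep_succ_inr_inr]

/-- [folklore] **B1 AT LEVEL `j + 1`, LEFT**: `comp (piK (ctr (d+1) Lc) Lc) (bhKStepSh d Lc (Dsh Lc) (j+1)) = bhKStepSh d Lc (Dsh Lc) (j+1)` — by
transposition (pattern `SymBorderedHessianStepBlind.comp_piKSymBm_bhKStep`). -/
theorem comp_piK_bhKStepSh_succ (j : ℕ) :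
    comp (piK (ctr (d + 1) Lc) Lc) (bhKStepSh d Lc (Dsh Lc) (j + 1)) = bhKStepSh d Lc (Dsh Lc) (j + 1) := by
  have h : trK (comp (piK (ctr (d + 1) Lc) Lc) (bhKStepSh d Lc (Dsh Lc) (j + 1))) = trK (bhKStepSh d Lc (Dsh Lc) (j + 1)) := by
    rw [trK_comp, trK_bhKStepSh_succ, ← sgnK_trK_piK, comp_sgnK, comp_bhKStepSh_succ_trK_piK]
  have h' := congrArg trK h
  rwa [trK_trK, trK_trK] at h'

/-- [folklore] **B1, RIGHT, EVERY LEVEL**: `comp (bhKStepSh d Lc (Dsh Lc) j) (trK (piK (ctr (d+1) Lc) Lc)) = bhKStepSh d Lc (Dsh Lc) j`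
(`j = 0`: `bhKStepSh_zero` + §3). -/
theorem comp_bhKStepSh_trK_piK : ∀ j : ℕ,
    comp (bhKStepSh d Lc (Dsh Lc) j) (trK (piK (ctr (d + 1) Lc) Lc)) = bhKStepSh d Lc (Dsh Lc) j
  | 0 => by rw [bhKStepSh_zero]; exact comp_bhKSym_trK_piK
  | j + 1 => comp_bhKStepSh_succ_trK_piK j

/-- [folklore] **B1, LEFT, EVERY LEVEL**: `comp (piK (ctr (d+1) Lc) Lc) (bhKStepSh d Lc (Dsh Lc) j) = bhKStepSh d Lc (Dsh Lc) j`. -/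
theorem comp_piK_bhKStepSh : ∀ j : ℕ,
    comp (piK (ctr (d + 1) Lc) Lc) (bhKStepSh d Lc (Dsh Lc) j) = bhKStepSh d Lc (Dsh Lc) j
  | 0 => by rw [bhKStepSh_zero]; exact comp_piK_bhKSym
  | j + 1 => comp_piK_bhKStepSh_succ j

end Step

end Summit.QuantumFields.BalabanUV.Beta.CombChartSpreadBlind

end
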